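import Summits.MatrixMultiplication.MatrixMultiplication.Theorems.FarEdgeDescentDialAnalysis
import Summits.MatrixMultiplication.MatrixMultiplication.Theorems.FarEdgeDescentDialSteps
import Summits.MatrixMultiplication.MatrixMultiplication.Theorems.FarEdgeDescentExactCeiling
import HarnessLib

/-!
# Far-edge descent, kernel XXXVIII-B: the ANCHOR-BUDGET DIAL — every mortal-anchor toolbox is power-capped

Route `FarEdgeDescent`, special leaf `FiniteSaturation` (stmt-MatrixMultiplication-23739): helper
kernel, THESES-FREE and def-free (decomp-mm lens 2 «structural dichotomy: special vs generic», gen 58).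

THE DICHOTOMY AS A ONE-PARAMETER THEOREM.  Kernel XXXVII-B (`exact_ceiling`) is the case `β = 2` of a
family: run the product-and-full-reanchor calculus with ANCHOR BUDGET FACTOR `β` — an anchored object
`⟨1,Q,1⟩ ⊕ legs` costs `r = Q + βL`, a re-anchored product has `Q'' = QQ' + β(β−1)LL'`,
`L'' = QL' + Q'L + LL'`, so `λ'' = λ + λ' − (2β−1)λλ'` (fixed point `1/(2β−1)`) and the exact step is
`F'' ≤ FF' + β(β−1)λλ'·min(1, e^{−τ(ℓ''−Λ)})` with `F ≡ 1 − (β−1)λ` at `s = t = 1` (dictionary: kernel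
XXXVIII-C).  In the coordinates `u = (2β−1)λ/3`, `a = 3(β−1)/(2β−1)` (`dial_of_budget`) this is the
`a`-dial of kernel XXXVIII-A, and this file proves, for EVERY `a ∈ (0,1]` (`β ∈ (1,2]`):

  `dial_ceiling`:  `∃ c > 0: 0 ≤ σ ≤ c·τ^{κ_a}, 0 < τ ≤ 1 ⟹ F_j ≤ 1 − a·u_j/2 < 1` for EVERY node of EVERY
  schedule,  `κ_a = log₂(2(3−a)/3) = log₂(2β/(2β−1)) ∈ [log₂(4/3), 1)`  (`dialKappa_pos_lt_one`),

hence (`dial_ceiling_powerWorld`) the power world of order `θ_a = κ_a/(1−κ_a) = log(2β/(2β−1))/log((2β−1)/β)`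
passes every exact readout of every schedule of the `β`-toolbox: `θ_2 = θ_S = 0.7095`, `θ_{7/4} = 0.943`,
`θ_{3/2} = 1.41`, `θ_{5/4} = 2.80`, and `θ_a ≥ 2log(4/3)/a → ∞` as `β → 1⁺` (`dialTheta_ge`,
`dialTheta_unbounded`) — but `κ_a < 1` for EVERY `β > 1`: NO mortal-anchor toolbox, however cheap its
anchors, produces the LINEAR wedge that `FiniteSaturation` is equivalent to
(`FarEdgeDescentMomentDichotomy.finiteSaturation_iff_linearWedge`); amplification moves the RATE and
never manufactures saturation.  Only the endpoint `β = 1` (`a = 0`, immortal anchors) is of saturation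
grade, and there the step is exactly multiplicative and towers are INERT (kernel XXXVIII-C): the special
leaf is a one-shot base-design problem.  Memo NODE-g53 §2 located the summit-hard content in «the factor
2»; this kernel makes the dial a theorem and shows the dial has no intermediate stop.

* dial analysis (kernel XXXVIII-0, `FarEdgeDescentDialAnalysis`): `dialKappa_pos_lt_one`, `dial_magic`
  (`(1−a/3)^{p_a} = 1/2`), `dial_of_budget`, `dialKappa_anti`, `dialTheta_ge`, `dialTheta_unbounded`;
* §1 `dialSchedule_invariant` (strong induction over the DAG, from XXXVIII-A `shallow_step_dial`,
  `deep_step_dial`), `dial_ceiling` (explicit `c`);  §2 `dial_ceiling_powerWorld` (via XXXVII-B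
  `powerWorld_of_wedge`).  At `a = 1` the statements are those of XXXVII-B up to `norm_num`
  (`2(3−1)/3 = 4/3`, `1·(3−1) = 2`); they are not restated.

References: Schönhage 1981, §5; Pan 1984 (LNCS 179) §16 Props. 16.2–16.5, §17 Thm. 17.1; Stothers 2010,
Thm. 8; Lotti–Romani 1983, Prop. 4.1; Knuth TAOCP 2 §4.6.4 Ex. 67(g),(h); Alman–Li 2026, Thm. 5.1,
Prop. 5.3 (budget `Q + 2L`); Hardy–Littlewood–Pólya, Thm. 13.
Tags: `FiniteSaturation` (h₁) NEC · WEAKER · ATTACKED; method ceiling of the whole anchor-budget family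
(BC9-type theorem: it bounds what these certificates prove, not `ω(1,k,1)`).
-/

set_option linter.dupNamespace false

noncomputable section

namespace Summit.MatrixMultiplication.MatrixMultiplication.Theorems.FarEdgeDescentDialCeiling

open Summit.MatrixMultiplication.MatrixMultiplication.Theorems.FarEdgeDescentImprovableRate
open Summit.MatrixMultiplication.MatrixMultiplication.Theorems.FarEdgeDescentAnchorTax
open Summit.MatrixMultiplication.MatrixMultiplication.Theorems.FarEdgeDescentExactSteps
open Summit.MatrixMultiplication.MatrixMultiplication.Theorems.FarEdgeDescentExactCeiling
open Summit.MatrixMultiplication.MatrixMultiplication.Theorems.FarEdgeDescentDialSteps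
open Summit.MatrixMultiplication.MatrixMultiplication.Theorems.FarEdgeDescentDialAnalysis

/-! ## §1 The invariant over an arbitrary schedule and the dial ceiling -/

/-- **THE DIAL SCHEDULE INVARIANT** (strong induction over any product-and-reanchor DAG; `0 < a ≤ 1`).
Nodes `j` are bases (`λ₀ ≤ u_j ≤ 1/3`, `0 ≤ ℓ_j`, `ℓ_j^κ ≤ B`, `0 ≤ F_j ≤ 1 − au_j + Φ₀σ(3u_j)^{1−κ}ℓ_j^κ`)
or products of two earlier nodes `m, n < j` with full re-anchoring (`u_j = u_m+u_n−3u_mu_n`,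
`ℓ_j = ℓ_m+ℓ_n`, `0 ≤ F_j ≤ F_mF_n + a(3−a)u_mu_n·min(1, exp(−τ(ℓ_j−Λ)))`).  Conclusion, for every node:
the MARGIN `F_j ≤ 1 − au_j/2`, and for SHALLOW nodes (`exp(−τ(ℓ_j−Λ)) > 1/2`) the potential bound
`F_j ≤ 1 − au_j + Φ₀exp(γℓ_j^κ)σ(3u_j)^{1−κ}ℓ_j^κ`.  Shallow children come from shallow parents
(`shallow_step_dial`); deep children inherit the margin (`deep_step_dial`, threshold `1/2` uniform in
`a`); a shallow node's excess is `≤ (2Cσℓ^κ)u ≤ au/2` (`excess_le`, `2CσB ≤ a/2`).  `a = 1`: XXXVII-B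
`exactSchedule_invariant`. [cite: Pan1984, Props. 16.2–16.5, Thm. 17.1] [cite: Schonhage1981, §5]
[cite: Stothers2010, Thm. 8] -/
theorem dialSchedule_invariant {κ p a l₀ Φ₀ C γ δ ζ σ τ Λ B : ℝ} (lam ℓ F : ℕ → ℝ)
    (hκ0 : 0 < κ) (hκ1 : κ < 1) (hp : p = 1 / (1 - κ)) (ha0 : 0 < a) (ha1 : a ≤ 1)
    (hmagic : (1 - a / 3) ^ p = 1 / 2) (hl₀ : 0 < l₀) (hΦ₀ : 0 ≤ Φ₀) (hC0 : 0 ≤ C)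
    (hC : Φ₀ * 3 ^ (1 - κ) ≤ C * l₀ ^ κ) (hσ : 0 ≤ σ) (hτ : 0 ≤ τ) (hγ0 : 0 ≤ γ)
    (hγ : C * σ ≤ γ * δ) (hζ0 : 0 < ζ) (hζ : ζ ^ κ ≤ a * l₀ / 4) (hδ : 1 + δ ≤ (1 + ζ) ^ κ)
    (hγB : γ * B ≤ Real.log 2) (hCB : 2 * C * σ * B ≤ a / 2)
    (hB : ∀ x : ℝ, 0 ≤ x → 1 / 2 < Real.exp (-(τ * (x - Λ))) → x ^ κ ≤ B)
    (H : ∀ j, (l₀ ≤ lam j ∧ lam j ≤ 1 / 3 ∧ 0 ≤ ℓ j ∧ ℓ j ^ κ ≤ B ∧ 0 ≤ F j ∧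
          F j ≤ 1 - a * lam j + Φ₀ * σ * ((3 * lam j) ^ (1 - κ) * ℓ j ^ κ)) ∨
        (∃ m, m < j ∧ ∃ n, n < j ∧ lam j = lam m + lam n - 3 * lam m * lam n ∧ ℓ j = ℓ m + ℓ n ∧
          0 ≤ F j ∧ F j ≤ F m * F n + a * (3 - a) * lam m * lam n ∧
          F j ≤ F m * F n + a * (3 - a) * lam m * lam n * Real.exp (-(τ * (ℓ j - Λ))))) :
    ∀ j, l₀ ≤ lam j ∧ lam j ≤ 1 / 3 ∧ 0 ≤ ℓ j ∧ 0 ≤ F j ∧ F j ≤ 1 - a * lam j / 2 ∧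
      (1 / 2 < Real.exp (-(τ * (ℓ j - Λ))) →
        F j ≤ 1 - a * lam j +
          Φ₀ * Real.exp (γ * ℓ j ^ κ) * σ * ((3 * lam j) ^ (1 - κ) * ℓ j ^ κ)) := by
  have ha3 : a ≤ 3 := by linarith
  -- the excess of a node with ℓ^κ ≤ B is at most a/2 times its share
  have hhalf : ∀ {x lm : ℝ}, 0 ≤ x → x ^ κ ≤ B → l₀ ≤ lm →
      Φ₀ * Real.exp (γ * x ^ κ) * σ * ((3 * lm) ^ (1 - κ) * x ^ κ) ≤ a * lm / 2 := by
    intro x lm hx hxB hlm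
    have h1 := excess_le hκ0 hl₀ hΦ₀ hC0 hC hσ hγ0 hx hxB hγB hlm
    have h2 : 2 * C * σ * x ^ κ * lm ≤ a / 2 * lm :=
      mul_le_mul_of_nonneg_right (le_trans (mul_le_mul_of_nonneg_left hxB (by positivity)) hCB)
        (le_trans hl₀.le hlm)
    linarith
  intro j
  induction j using Nat.strong_induction_on with
  | _ j ih => ?_
  rcases H j with ⟨h0, h1, h2, h3, h4, h5⟩ | ⟨m, hm, n, hn, e1, e2, h4, h5, h6⟩
  · -- base node
    have hl : 0 ≤ lam j := le_trans hl₀.le h0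
    have hpot : F j ≤ 1 - a * lam j +
        Φ₀ * Real.exp (γ * ℓ j ^ κ) * σ * ((3 * lam j) ^ (1 - κ) * ℓ j ^ κ) := by
      have hexp : 1 ≤ Real.exp (γ * ℓ j ^ κ) := by
        have : 0 ≤ γ * ℓ j ^ κ := mul_nonneg hγ0 (Real.rpow_nonneg h2 κ)
        linarith [Real.add_one_le_exp (γ * ℓ j ^ κ)]
      have hR : 0 ≤ Φ₀ * σ * ((3 * lam j) ^ (1 - κ) * ℓ j ^ κ) := by positivity
      have : Φ₀ * σ * ((3 * lam j) ^ (1 - κ) * ℓ j ^ κ) ≤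
          Φ₀ * Real.exp (γ * ℓ j ^ κ) * σ * ((3 * lam j) ^ (1 - κ) * ℓ j ^ κ) := by
        calc Φ₀ * σ * ((3 * lam j) ^ (1 - κ) * ℓ j ^ κ)
            = Φ₀ * σ * ((3 * lam j) ^ (1 - κ) * ℓ j ^ κ) * 1 := (mul_one _).symm
          _ ≤ Φ₀ * σ * ((3 * lam j) ^ (1 - κ) * ℓ j ^ κ) * Real.exp (γ * ℓ j ^ κ) :=
              mul_le_mul_of_nonneg_left hexp hR
          _ = _ := by ring
      linarith
    exact ⟨h0, h1, h2, h4, by linarith [hhalf h2 h3 h0], fun _ => hpot⟩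
  · -- product node
    obtain ⟨a0, a1, a2, a3, a4, a5⟩ := ih m hm
    obtain ⟨b0, b1, b2, b3, b4, b5⟩ := ih n hn
    have a0' : 0 ≤ lam m := le_trans hl₀.le a0
    have b0' : 0 ≤ lam n := le_trans hl₀.le b0
    have hw := lam_step a0 a1 b0' b1
    have hℓj : 0 ≤ ℓ j := by rw [e2]; linarith
    have hshallow : 1 / 2 < Real.exp (-(τ * (ℓ j - Λ))) → F j ≤ 1 - a * lam j +
        Φ₀ * Real.exp (γ * ℓ j ^ κ) * σ * ((3 * lam j) ^ (1 - κ) * ℓ j ^ κ) := by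
      intro hs
      have hsa : 1 / 2 < Real.exp (-(τ * (ℓ m - Λ))) :=
        lt_of_lt_of_le hs (Real.exp_le_exp.2 (by rw [e2]; linarith [mul_nonneg hτ b2]))
      have hsb : 1 / 2 < Real.exp (-(τ * (ℓ n - Λ))) :=
        lt_of_lt_of_le hs (Real.exp_le_exp.2 (by rw [e2]; linarith [mul_nonneg hτ a2]))
      have pa := a5 hsa
      have pb := b5 hsb
      rcases le_total (ℓ n) (ℓ m) with hba | hab
      · have haB : ℓ m ^ κ ≤ B := hB _ a2 hsa
        have := shallow_step_dial hκ0 hκ1 hp ha0.le ha1 hmagic hl₀ hΦ₀ hC0 hC hσ hγ0 hγ hζ0 hζ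
          hδ hγB hCB a0 a1 b0 b1 b2 hba haB a3 pa b3 pb h5
        rw [e1, e2]; exact this
      · have hbB : ℓ n ^ κ ≤ B := hB _ b2 hsb
        have h5' : F j ≤ F n * F m + a * (3 - a) * lam n * lam m := by linarith [h5]
        have := shallow_step_dial hκ0 hκ1 hp ha0.le ha1 hmagic hl₀ hΦ₀ hC0 hC hσ hγ0 hγ hζ0 hζ
          hδ hγB hCB b0 b1 a0 a1 a2 hab hbB b3 pb a3 pa h5'
        have ew : lam n + lam m - 3 * lam n * lam m = lam m + lam n - 3 * lam m * lam n := by ring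
        have eℓ : ℓ n + ℓ m = ℓ m + ℓ n := by ring
        rw [ew, eℓ] at this
        rw [e1, e2]; exact this
    refine ⟨by rw [e1]; exact hw.1, by rw [e1]; exact hw.2, hℓj, h4, ?_, hshallow⟩
    rcases lt_or_ge (1 / 2 : ℝ) (Real.exp (-(τ * (ℓ j - Λ)))) with hs | hd
    · have hjB : ℓ j ^ κ ≤ B := hB _ hℓj hs
      have := hhalf hℓj hjB (show l₀ ≤ lam j by rw [e1]; exact hw.1)
      linarith [hshallow hs]
    · have := deep_step_dial ha0.le ha3 a0' b0' a3 a4 b3 b4 hd h6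
      rw [e1]; exact this

/-- **THE DIAL CEILING — every anchor budget `β ∈ (1,2]` is power-capped.**  Fix `a ∈ (0,1]`
(`a = 3(β−1)/(2β−1)`) and a finite base family: shares `u_B ≥ λ₀ > 0`, log-lengths `ℓ_B ≤ ℓ₁`, base census
constant `Φ₀` (`F_B ≤ 1 − au_B + Φ₀σ(3u_B)^{1−κ_a}ℓ_B^{κ_a}`, `σ = s − 1`) and `Λ ≥ 0`.  Then there is `c > 0`
such that at every sub-tangent parameter `(σ,τ)` with `0 < τ ≤ 1`, `0 ≤ σ ≤ c·τ^{κ_a}`,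
`κ_a = log₂(2(3−a)/3)`, EVERY node of EVERY product-and-full-reanchor schedule of the `β`-toolbox over the
family satisfies `F_j ≤ 1 − au_j/2 < 1`: its exact readout PASSES with margin.  So no such schedule
excludes any point of the wedge `s − 1 ≤ c(1−t)^{κ_a}`, and the rate ladder built on the `β`-toolbox is
capped at the order `θ_a = κ_a/(1−κ_a)` — finite for every `β > 1` and unbounded as `β → 1⁺`
(`dialTheta_unbounded`), while the saturation-grade linear wedge (`κ = 1`) is never reached
(`dialKappa_pos_lt_one`).  `a = 1` (`β = 2`) is XXXVII-B `exact_ceiling` (`θ_S = 0.7095…`).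
Constants: `ζ = (aλ₀/4)^{1/κ}`, `δ = (1+ζ)^κ − 1`, `C = Φ₀3^{1−κ}/λ₀^κ`, `T = Λ + log 2`,
`c = min(δ log 2, a/4)/(C(T^κ + ℓ₁^κ) + 1)`.
[cite: Pan1984, Props. 16.2–16.5, Thm. 17.1] [cite: Schonhage1981, §5] [cite: Stothers2010, Thm. 8]
[cite: LottiRomani1983, Prop. 4.1] [cite: AlmanLi2026, Thm. 5.1] -/
theorem dial_ceiling {a l₀ ℓ₁ Φ₀ Λ : ℝ} (ha0 : 0 < a) (ha1 : a ≤ 1) (hl₀ : 0 < l₀) (hℓ₁ : 0 ≤ ℓ₁)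
    (hΦ₀ : 0 ≤ Φ₀) (hΛ : 0 ≤ Λ) :
    ∃ c : ℝ, 0 < c ∧ ∀ (σ τ : ℝ) (lam ℓ F : ℕ → ℝ), 0 ≤ σ → 0 < τ → τ ≤ 1 →
      σ ≤ c * τ ^ Real.logb 2 (2 * (3 - a) / 3) →
      (∀ j, (l₀ ≤ lam j ∧ lam j ≤ 1 / 3 ∧ 0 ≤ ℓ j ∧ ℓ j ≤ ℓ₁ ∧ 0 ≤ F j ∧
            F j ≤ 1 - a * lam j + Φ₀ * σ * ((3 * lam j) ^ (1 - Real.logb 2 (2 * (3 - a) / 3)) *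
              ℓ j ^ Real.logb 2 (2 * (3 - a) / 3))) ∨
          (∃ m, m < j ∧ ∃ n, n < j ∧ lam j = lam m + lam n - 3 * lam m * lam n ∧
            ℓ j = ℓ m + ℓ n ∧ 0 ≤ F j ∧ F j ≤ F m * F n + a * (3 - a) * lam m * lam n ∧
            F j ≤ F m * F n + a * (3 - a) * lam m * lam n * Real.exp (-(τ * (ℓ j - Λ))))) →
      ∀ j, F j ≤ 1 - a * lam j / 2 := by
  obtain ⟨hκ0, hκ1⟩ := dialKappa_pos_lt_one ha0 (by linarith)
  set κ : ℝ := Real.logb 2 (2 * (3 - a) / 3) with hκ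
  have h1κ : 0 < 1 - κ := by linarith
  obtain ⟨p, hp⟩ : ∃ p : ℝ, p = 1 / (1 - κ) := ⟨_, rfl⟩
  have hmagic : (1 - a / 3) ^ p = 1 / 2 := by rw [hp, hκ]; exact dial_magic ha0 (by linarith)
  -- the constants of the schedule-free part
  have hal : 0 < a * l₀ / 4 := by positivity
  obtain ⟨ζ, hζdef⟩ : ∃ ζ : ℝ, ζ = (a * l₀ / 4) ^ (1 / κ) := ⟨_, rfl⟩
  have hζ0 : 0 < ζ := by rw [hζdef]; exact Real.rpow_pos_of_pos hal _
  have hζ : ζ ^ κ ≤ a * l₀ / 4 := by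
    rw [hζdef, ← Real.rpow_mul hal.le, one_div_mul_cancel hκ0.ne', Real.rpow_one]
  obtain ⟨δ, hδdef⟩ : ∃ δ : ℝ, δ = (1 + ζ) ^ κ - 1 := ⟨_, rfl⟩
  have hδ0 : 0 < δ := by rw [hδdef, sub_pos]; exact Real.one_lt_rpow (by linarith) hκ0
  have hδ : 1 + δ ≤ (1 + ζ) ^ κ := by rw [hδdef]; linarith
  have hl₀κ : 0 < l₀ ^ κ := Real.rpow_pos_of_pos hl₀ κ
  obtain ⟨C, hCdef⟩ : ∃ C : ℝ, C = Φ₀ * 3 ^ (1 - κ) / l₀ ^ κ := ⟨_, rfl⟩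
  have hC0 : 0 ≤ C := by rw [hCdef]; positivity
  have hC : Φ₀ * 3 ^ (1 - κ) ≤ C * l₀ ^ κ := by rw [hCdef, div_mul_cancel₀ _ hl₀κ.ne']
  have hlog2 : 0 < Real.log 2 := Real.log_pos (by norm_num)
  obtain ⟨T, hTdef⟩ : ∃ T : ℝ, T = Λ + Real.log 2 := ⟨_, rfl⟩
  have hT0 : 0 < T := by rw [hTdef]; linarith
  obtain ⟨W, hWdef⟩ : ∃ W : ℝ, W = T ^ κ + ℓ₁ ^ κ := ⟨_, rfl⟩
  have hW0 : 0 ≤ W := by rw [hWdef]; positivity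
  have hmin0 : 0 < min (δ * Real.log 2) (a / 4) := lt_min (by positivity) (by positivity)
  have hCW1 : 0 < C * W + 1 := by positivity
  obtain ⟨c, hcdef⟩ : ∃ c : ℝ, c = min (δ * Real.log 2) (a / 4) / (C * W + 1) := ⟨_, rfl⟩
  have hc0 : 0 < c := by rw [hcdef]; positivity
  refine ⟨c, hc0, ?_⟩
  intro σ τ lam ℓ F hσ hτ hτ1 hστ H j
  -- the shallow-length bound B and the two smallness conditions at (σ, τ)
  have hTτ : 0 ≤ T / τ := by positivity
  obtain ⟨B, hBdef⟩ : ∃ B : ℝ, B = (T / τ) ^ κ + ℓ₁ ^ κ := ⟨_, rfl⟩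
  have hB1 : ℓ₁ ^ κ ≤ B := by rw [hBdef]; linarith [Real.rpow_nonneg hTτ κ]
  have hBnn : 0 ≤ B := le_trans (Real.rpow_nonneg hℓ₁ κ) hB1
  have hB : ∀ x : ℝ, 0 ≤ x → 1 / 2 < Real.exp (-(τ * (x - Λ))) → x ^ κ ≤ B := by
    intro x hx hs
    have h1 : Real.log (1 / 2) < -(τ * (x - Λ)) := by
      by_contra hcon
      push Not at hcon
      have h := Real.exp_le_exp.2 hcon
      rw [Real.exp_log (by norm_num)] at h
      linarith
    have h12 : Real.log (1 / 2 : ℝ) = -Real.log 2 := by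
      rw [← Real.log_inv]; norm_num
    have hτΛ : τ * Λ ≤ Λ := mul_le_of_le_one_left hΛ hτ1
    have h2 : x * τ ≤ T := by rw [hTdef]; nlinarith
    have h3 : x ≤ T / τ := by rw [le_div_iff₀ hτ]; exact h2
    have h4 : x ^ κ ≤ (T / τ) ^ κ := Real.rpow_le_rpow hx h3 hκ0.le
    rw [hBdef]; linarith [Real.rpow_nonneg hℓ₁ κ]
  have hτκ1 : τ ^ κ ≤ 1 := Real.rpow_le_one hτ.le hτ1 hκ0.le
  have hσB : σ * B ≤ c * W := by
    have e0 : τ * (T / τ) = T := by field_simp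
    have e1 : τ ^ κ * (T / τ) ^ κ = T ^ κ := by rw [← Real.mul_rpow hτ.le hTτ, e0]
    have hℓ₁κ : 0 ≤ ℓ₁ ^ κ := Real.rpow_nonneg hℓ₁ κ
    calc σ * B ≤ c * τ ^ κ * B := mul_le_mul_of_nonneg_right hστ hBnn
      _ = c * (τ ^ κ * (T / τ) ^ κ + τ ^ κ * ℓ₁ ^ κ) := by rw [hBdef]; ring
      _ = c * (T ^ κ + τ ^ κ * ℓ₁ ^ κ) := by rw [e1]
      _ ≤ c * (T ^ κ + ℓ₁ ^ κ) := by
          apply mul_le_mul_of_nonneg_left _ hc0.le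
          linarith [mul_le_of_le_one_left hℓ₁κ hτκ1]
      _ = c * W := by rw [hWdef]
  have hcW : C * (c * W) ≤ min (δ * Real.log 2) (a / 4) := by
    have e : C * (c * W) = min (δ * Real.log 2) (a / 4) * (C * W) / (C * W + 1) := by
      rw [hcdef]; ring
    rw [e, div_le_iff₀ hCW1]
    exact mul_le_mul_of_nonneg_left (by linarith) hmin0.le
  have hCσB : C * σ * B ≤ min (δ * Real.log 2) (a / 4) := by
    calc C * σ * B = C * (σ * B) := by ring
      _ ≤ C * (c * W) := mul_le_mul_of_nonneg_left hσB hC0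
      _ ≤ _ := hcW
  obtain ⟨γ, hγdef⟩ : ∃ γ : ℝ, γ = C * σ / δ := ⟨_, rfl⟩
  have hγ0 : 0 ≤ γ := by rw [hγdef]; positivity
  have hγ : C * σ ≤ γ * δ := by rw [hγdef, div_mul_cancel₀ _ hδ0.ne']
  have hγB : γ * B ≤ Real.log 2 := by
    have e : γ * B = C * σ * B / δ := by rw [hγdef]; ring
    rw [e, div_le_iff₀ hδ0]
    calc C * σ * B ≤ min (δ * Real.log 2) (a / 4) := hCσB
      _ ≤ δ * Real.log 2 := min_le_left _ _
      _ = Real.log 2 * δ := mul_comm _ _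
  have hCB : 2 * C * σ * B ≤ a / 2 := by
    have := le_trans hCσB (min_le_right _ _)
    linarith
  -- feed the invariant
  have H' : ∀ j, (l₀ ≤ lam j ∧ lam j ≤ 1 / 3 ∧ 0 ≤ ℓ j ∧ ℓ j ^ κ ≤ B ∧ 0 ≤ F j ∧
        F j ≤ 1 - a * lam j + Φ₀ * σ * ((3 * lam j) ^ (1 - κ) * ℓ j ^ κ)) ∨
      (∃ m, m < j ∧ ∃ n, n < j ∧ lam j = lam m + lam n - 3 * lam m * lam n ∧ ℓ j = ℓ m + ℓ n ∧
        0 ≤ F j ∧ F j ≤ F m * F n + a * (3 - a) * lam m * lam n ∧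
        F j ≤ F m * F n + a * (3 - a) * lam m * lam n * Real.exp (-(τ * (ℓ j - Λ)))) := by
    intro i
    rcases H i with ⟨h0, h1, h2, h3, h4, h5⟩ | hstep
    · exact Or.inl ⟨h0, h1, h2, le_trans (Real.rpow_le_rpow h2 h3 hκ0.le) hB1, h4, h5⟩
    · exact Or.inr hstep
  exact (dialSchedule_invariant lam ℓ F hκ0 hκ1 hp ha0 ha1 hmagic hl₀ hΦ₀ hC0 hC hσ hτ.le hγ0 hγ
    hζ0 hζ hδ hγB hCB hB H' j).2.2.2.2.1

/-! ## §2 Consequence: the power world of order `θ_a` passes every exact readout of the `β`-toolbox -/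

/-- **THE POWER WORLD OF ORDER `θ_a` PASSES EVERY EXACT READOUT OF EVERY SCHEDULE OF THE `β`-TOOLBOX.**
For `a ∈ (0,1]` and a base family as in `dial_ceiling` there is `M > 0` such that at every `(s,t)`
(`1 ≤ s`, `0 ≤ t < 1`) sub-tangent to the model profile `x ↦ x + 1 + M·x^{−θ_a}`,
`θ_a = κ_a/(1−κ_a) = log(2β/(2β−1))/log((2β−1)/β)`, every node of every product-and-full-reanchor schedule
passes with margin `F_j ≤ 1 − au_j/2`.  So an excess `e(k) = ω(1,k,1) − (k+1) ≍ k^{−θ_a}` is compatible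
with EVERY exact certificate of the `β`-toolbox; as `β ↓ 1` the compatible orders `θ_a → ∞`
(`dialTheta_unbounded`), but for no `β > 1` is a positive excess at all large `k` excluded — the abstract
form of «amplification never manufactures `FiniteSaturation`».  METHOD CEILING (BC9-type): it bounds what
these certificates can prove, not `ω(1,k,1)` itself; `a = 1` is XXXVII-B `exact_ceiling_powerWorld`.
[cite: Pan1984, Thm. 17.1] [cite: Schonhage1981, §5] [cite: Stothers2010, Thm. 8] [cite: LottiRomani1983, Prop. 4.1] -/
theorem dial_ceiling_powerWorld {a l₀ ℓ₁ Φ₀ Λ : ℝ} (ha0 : 0 < a) (ha1 : a ≤ 1) (hl₀ : 0 < l₀)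
    (hℓ₁ : 0 ≤ ℓ₁) (hΦ₀ : 0 ≤ Φ₀) (hΛ : 0 ≤ Λ) :
    ∃ M : ℝ, 0 < M ∧ ∀ s t : ℝ, 1 ≤ s → 0 ≤ t → t < 1 →
      (∀ x : ℝ, 0 < x → s + x * t ≤ x + 1 +
        M * x ^ (-(Real.logb 2 (2 * (3 - a) / 3) / (1 - Real.logb 2 (2 * (3 - a) / 3))))) →
      ∀ (lam ℓ F : ℕ → ℝ),
        (∀ j, (l₀ ≤ lam j ∧ lam j ≤ 1 / 3 ∧ 0 ≤ ℓ j ∧ ℓ j ≤ ℓ₁ ∧ 0 ≤ F j ∧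
              F j ≤ 1 - a * lam j + Φ₀ * (s - 1) *
                ((3 * lam j) ^ (1 - Real.logb 2 (2 * (3 - a) / 3)) *
                  ℓ j ^ Real.logb 2 (2 * (3 - a) / 3))) ∨
            (∃ m, m < j ∧ ∃ n, n < j ∧ lam j = lam m + lam n - 3 * lam m * lam n ∧
              ℓ j = ℓ m + ℓ n ∧ 0 ≤ F j ∧ F j ≤ F m * F n + a * (3 - a) * lam m * lam n ∧
              F j ≤ F m * F n + a * (3 - a) * lam m * lam n *
                Real.exp (-((1 - t) * (ℓ j - Λ))))) →
        ∀ j, F j ≤ 1 - a * lam j / 2 := by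
  obtain ⟨c, hc, hcl⟩ := dial_ceiling ha0 ha1 hl₀ hℓ₁ hΦ₀ hΛ
  obtain ⟨hκ0, hκ1⟩ := dialKappa_pos_lt_one ha0 (by linarith)
  obtain ⟨M, hM, h⟩ := powerWorld_of_wedge hκ0 hκ1 hc
    (fun s t => ∀ (lam ℓ F : ℕ → ℝ),
        (∀ j, (l₀ ≤ lam j ∧ lam j ≤ 1 / 3 ∧ 0 ≤ ℓ j ∧ ℓ j ≤ ℓ₁ ∧ 0 ≤ F j ∧
              F j ≤ 1 - a * lam j + Φ₀ * (s - 1) *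
                ((3 * lam j) ^ (1 - Real.logb 2 (2 * (3 - a) / 3)) *
                  ℓ j ^ Real.logb 2 (2 * (3 - a) / 3))) ∨
            (∃ m, m < j ∧ ∃ n, n < j ∧ lam j = lam m + lam n - 3 * lam m * lam n ∧
              ℓ j = ℓ m + ℓ n ∧ 0 ≤ F j ∧ F j ≤ F m * F n + a * (3 - a) * lam m * lam n ∧
              F j ≤ F m * F n + a * (3 - a) * lam m * lam n *
                Real.exp (-((1 - t) * (ℓ j - Λ))))) →
        ∀ j, F j ≤ 1 - a * lam j / 2)
    (fun s t hs ht0 ht1 hw lam ℓ F H j =>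
      hcl (s - 1) (1 - t) lam ℓ F (by linarith) (by linarith) (by linarith) hw H j)
  exact ⟨M, hM, fun s t hs ht0 ht1 hsub lam ℓ F H j => h s t hs ht0 ht1 hsub lam ℓ F H j⟩

end Summit.MatrixMultiplication.MatrixMultiplication.Theorems.FarEdgeDescentDialCeiling

end
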